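import Literature.Geometry.Kaehler.ComplexTorusDivisorClassGroup
import Literature.Geometry.Kaehler.ComplexTorusDivisorClassesIsogeny
import HarnessLib

/-!
# `G_div(X)` acts trivially on the ring of divisor classes `D•(X)` (Moonen–Zarhin 1998, Lemma (11)(3), `⊇`)

Layer `Literature/Geometry/Kaehler`, namespace `Literature.Geometry.Kaehler.ComplexTorus`; lane
`lit-hodgefound` (Track 2 foundations library), Layer A4; FILE 2 of the self-proposed row «Q143⁺ · Q72⁺ ·
A2-31⁺ · Q363⁺ — Moonen–Zarhin 1998 (10): `G_div(X)`» (FILE 1: `ComplexTorusDivisorClassGroup.lean`,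
`divisorClassGroup Φ η₀ = G_div(X)(ℝ)` = the pointwise stabiliser of the divisor classes `H²_Hodge(X)`).
Here the easy inclusions of Lemma (11)(3): every element of `SL(V_ℝ)` fixing the divisor classes
`B¹(X) = H²_Hodge(X)` fixes their products `Dᵖ(X)` (A4-15 `divisorClasses Φ p`: the `ℚ`-span of the wedge
monomials `E₁ ∧ ⋯ ∧ E_p`, `Eᵢ ∈ NS(X)`), because pull-back is multiplicative
(`wedgeFamily_compContinuousLinearMap`); hence `G_div(X)`, `Lf(X) ⊆ G_div(X)` and `Hg(X) ⊆ G_div(X)` act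
trivially on `D•(X)`: `D•(X) ⊆ (⊕_i ⋀^i V_X)^{G_div(X)}`.

Source, verbatim. B. J. J. Moonen, Yu. G. Zarhin, *Weil classes on abelian varieties*, J. reine angew.
Math. 496 (1998), held `paper:arxiv-alg-geom_9612017`, Lemma (11)(3) (arXiv numbering; p. 3 L5–L6):
"(3) `End(V_X)^{G_div(X)} = B`; `(⋀² V_X)^{G_div(X)} = B¹(X)`, and `(⊕_i ⋀^i V_X)^{G_div(X)} = D•(X)`."
with "Proof. […] The last statement is based on results from classical invariant theory". The
inclusions `B¹(X) ⊆ (⋀² V_X)^{G_div}` (FILE 1, by definition of the stabiliser) and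
`D•(X) ⊆ (⊕ ⋀^i V_X)^{G_div}` (this file) are proved, together with (add-only sequel at the end)
`(⊕ ⋀^i V_X)^{G_div} ⊆ B•(X)` from `Hg(X) ⊆ G_div(X)` — whence the printed EQUALITY in degree two,
`(⋀² V_X)^{G_div(X)} = B¹(X)`; the equality `(⊕ ⋀^i V_X)^{G_div} = D•(X)` in higher degrees (invariant
theory of `G_div ⊗ ℂ`, [Kum1], [Haz1]) is NOT here.

## References

* [MoonenZarhin1998WeilClasses] B. J. J. Moonen, Yu. G. Zarhin, *Weil classes on abelian varieties*,
  J. reine angew. Math. 496 (1998), (10) and Lemma (11)(3).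
* [Lange2023AbelianVarietiesComplex] H. Lange, *Abelian Varieties over the Complex Numbers* (2023), §7.3.1
  (`D•(X)`), §7.2.2 Thm. 7.2.4.
-/

noncomputable section

open Complex Function Module Matrix

namespace Literature.Geometry.Kaehler

namespace ComplexTorus

variable {ι : Type*} [Fintype ι] [DecidableEq ι] {E : Type*} [NormedAddCommGroup E] [NormedSpace ℂ E]
  (Φ : (ι → ℝ) ≃L[ℝ] E)

/-- **Fixing the divisor classes is fixing their products**: an element of `SL(V_ℝ)` acting trivially on
`B¹(X) = H²_Hodge(X)` acts trivially on `Dᵖ(X)` for every `p` (pull-back is multiplicative on wedge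
monomials `E₁ ∧ ⋯ ∧ E_p`, `Eᵢ ∈ NS(X) ⊆ B¹(X)`). [cite: MoonenZarhin1998WeilClasses, Lemma (11)(3) (`D•(X) ⊆ (⊕ ⋀^i V_X)^{G_div}`)]
[cite: Lange2023AbelianVarietiesComplex, §7.3.1] -/
theorem formsStabilizer_hodgeClasses_one_le_formsStabilizer_divisorClasses (p : ℕ) :
    formsStabilizer Φ (hodgeClasses Φ 1 : Set (E [⋀^Fin 2]→L[ℝ] ℂ)) ≤
      formsStabilizer Φ (divisorClasses Φ p : Set (E [⋀^Fin (2 * p)]→L[ℝ] ℂ)) := by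
  intro M hM
  -- `M` fixes every generator `E₁ ∧ ⋯ ∧ E_p`
  have hgen : M ∈ formsStabilizer Φ (Set.range fun η : Fin p → neronSeveriGroup Φ ↦
      wedgeFamily p fun i ↦ ofRealForm ((η i : neronSeveriGroup Φ) : E [⋀^Fin 2]→L[ℝ] ℝ)) := by
    rintro _ ⟨η, rfl⟩
    rw [wedgeFamily_compContinuousLinearMap]
    congr 1
    funext i
    exact hM _ (ofRealForm_mem_hodgeClasses_one Φ (η i).2)
  -- hence their `ℂ`-span, which contains the `ℚ`-span `Dᵖ(X)`
  rw [← formsStabilizer_span] at hgen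
  refine formsStabilizer_anti Φ ?_ hgen
  intro γ hγ
  exact Submodule.span_le_restrictScalars ℚ ℂ _ hγ

/-- **`Hg(X)` acts trivially on `D•(X)`** (Thm. 7.2.4, Step I, with `Dᵖ ⊆ H^{2p}_Hodge`).
[cite: Lange2023AbelianVarietiesComplex, §7.2.2 Thm. 7.2.4 and §7.3.1] -/
theorem hodgeGroup_le_formsStabilizer_divisorClasses (p : ℕ) :
    hodgeGroup Φ ≤ formsStabilizer Φ (divisorClasses Φ p : Set (E [⋀^Fin (2 * p)]→L[ℝ] ℂ)) :=
  (hodgeGroup_le_formsStabilizer_hodgeClasses Φ 1).trans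
    (formsStabilizer_hodgeClasses_one_le_formsStabilizer_divisorClasses Φ p)

section Polarised

variable {Φ} {η₀ : E [⋀^Fin 2]→L[ℝ] ℝ} {G₀ : Matrix ι ι ℚ}

/-- **Moonen–Zarhin, Lemma (11)(3), the inclusion `D•(X) ⊆ (⊕_i ⋀^i V_X)^{G_div(X)}`: `G_div(X)` acts
trivially on the divisor classes of every codimension** (`G_div(X)(ℝ)` is the stabiliser of `B¹(X)`, FILE 1,
and fixing `B¹` is fixing `D•`). [cite: MoonenZarhin1998WeilClasses, Lemma (11)(3)] -/
theorem divisorClassGroup_le_formsStabilizer_divisorClasses (h₀ : ∀ u v : E, η₀ ![I • u, I • v] = η₀ ![u, v])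
    (hG₀ : G₀.map ((↑) : ℚ → ℝ) = latticeGram Φ η₀) (hdet : IsUnit G₀.det) (p : ℕ) :
    divisorClassGroup Φ η₀ ≤ formsStabilizer Φ (divisorClasses Φ p : Set (E [⋀^Fin (2 * p)]→L[ℝ] ℂ)) := by
  rw [← formsStabilizer_hodgeClasses_one_eq_divisorClassGroup h₀ hG₀ hdet]
  exact formsStabilizer_hodgeClasses_one_le_formsStabilizer_divisorClasses Φ p

/-- The same, membership form: `ρ(M)^* γ = γ` for `γ ∈ Dᵖ(X)` and `M ∈ G_div(X)(ℝ)`.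
[cite: MoonenZarhin1998WeilClasses, Lemma (11)(3)] -/
theorem compContinuousLinearMap_eq_of_mem_divisorClassGroup (h₀ : ∀ u v : E, η₀ ![I • u, I • v] = η₀ ![u, v])
    (hG₀ : G₀.map ((↑) : ℚ → ℝ) = latticeGram Φ η₀) (hdet : IsUnit G₀.det) {p : ℕ}
    {γ : E [⋀^Fin (2 * p)]→L[ℝ] ℂ} (hγ : γ ∈ divisorClasses Φ p) {M : SpecialLinearGroup ι ℝ}
    (hM : M ∈ divisorClassGroup Φ η₀) : γ.compContinuousLinearMap (analyticRepReal Φ Φ M.1) = γ :=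
  divisorClassGroup_le_formsStabilizer_divisorClasses h₀ hG₀ hdet p hM γ hγ

/-- **`Lf(X)` acts trivially on `D•(X)`** for a polarised abelian variety (`Lf ⊆ G_div`).
[cite: MoonenZarhin1998WeilClasses, (10) and Lemma (11)(3)] [cite: Lange2023AbelianVarietiesComplex, §7.2.4 Exercise (4)] -/
theorem lefschetzGroup_le_formsStabilizer_divisorClasses (h₀ : ∀ u v : E, η₀ ![I • u, I • v] = η₀ ![u, v])
    (hG₀ : G₀.map ((↑) : ℚ → ℝ) = latticeGram Φ η₀) (hdet : IsUnit G₀.det) (p : ℕ) :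
    lefschetzGroup Φ η₀ ≤ formsStabilizer Φ (divisorClasses Φ p : Set (E [⋀^Fin (2 * p)]→L[ℝ] ℂ)) :=
  (lefschetzGroup_le_divisorClassGroup Φ η₀).trans (divisorClassGroup_le_formsStabilizer_divisorClasses h₀ hG₀ hdet p)

/-- `Lf(X)` fixes every divisor class (`p = 1`: `Lf ⊆ G_div = Stab(B¹)`). [cite: MoonenZarhin1998WeilClasses, (10)] -/
theorem lefschetzGroup_le_formsStabilizer_hodgeClasses_one (h₀ : ∀ u v : E, η₀ ![I • u, I • v] = η₀ ![u, v])
    (hG₀ : G₀.map ((↑) : ℚ → ℝ) = latticeGram Φ η₀) (hdet : IsUnit G₀.det) :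
    lefschetzGroup Φ η₀ ≤ formsStabilizer Φ (hodgeClasses Φ 1 : Set (E [⋀^Fin 2]→L[ℝ] ℂ)) := by
  rw [formsStabilizer_hodgeClasses_one_eq_divisorClassGroup h₀ hG₀ hdet]
  exact lefschetzGroup_le_divisorClassGroup Φ η₀

/-- For a polarised abelian variety `(X, L₀)`: `G_div(X)` acts trivially on `D•(X)`.
[cite: MoonenZarhin1998WeilClasses, Lemma (11)(3)] -/
theorem IsRiemannForm.divisorClassGroup_le_formsStabilizer_divisorClasses (h : IsRiemannForm Φ η₀) (p : ℕ) :
    divisorClassGroup Φ η₀ ≤ formsStabilizer Φ (divisorClasses Φ p : Set (E [⋀^Fin (2 * p)]→L[ℝ] ℂ)) := by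
  rw [← h.formsStabilizer_hodgeClasses_one_eq]
  exact formsStabilizer_hodgeClasses_one_le_formsStabilizer_divisorClasses Φ p

/-- For a polarised abelian variety: `Lf(X)` acts trivially on `D•(X)` and on `B¹(X)`.
[cite: MoonenZarhin1998WeilClasses, (10) and Lemma (11)(3)] -/
theorem IsRiemannForm.lefschetzGroup_le_formsStabilizer_divisorClasses (h : IsRiemannForm Φ η₀) (p : ℕ) :
    lefschetzGroup Φ η₀ ≤ formsStabilizer Φ (divisorClasses Φ p : Set (E [⋀^Fin (2 * p)]→L[ℝ] ℂ)) := by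
  obtain ⟨G₀, hG₀, hdet⟩ := h.exists_ratMatrix_latticeGram_isUnit
  exact ComplexTorus.lefschetzGroup_le_formsStabilizer_divisorClasses h.1 hG₀ hdet p

end Polarised

/-! ## (add-only sequel) The converse inclusions granted by `Hg(X) ⊆ G_div(X)`:
`(⊕_i ⋀^i V_X)^{G_div(X)} ⊆ B•(X)`, and in degree two `(⋀² V_X)^{G_div(X)} = B¹(X)`

Moonen–Zarhin (10) (FILE 1, `hodgeGroup_le_divisorClassGroup`): `G_div(X)` is the largest `ℚ`-subgroup fixing the
divisor classes, in particular `Hg(X) ⊆ G_div(X)`. Hence a rational class fixed by `G_div(X)(ℝ)` is fixed by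
`Hg(X)(ℝ)`, i.e. is a Hodge class (Lange Thm. 7.2.4, `mem_hodgeClasses_iff_forall_mem_hodgeGroup`): the
`G_div`-invariants are squeezed `Dᵖ(X) ⊆ (⋀^{2p} V_X)^{G_div(X)} ⊆ Bᵖ(X)`, and for `p = 1`, where
`D¹(X) = B¹(X) = H²_Hodge(X)`, this is the printed equality `(⋀² V_X)^{G_div(X)} = B¹(X)` of Lemma (11)(3). (The
equality `(⊕ ⋀^i V_X)^{G_div} = D•(X)` in higher degrees — classical invariant theory — is still NOT here.) -/

section InvariantsAreHodge

variable {Φ} {η₀ : E [⋀^Fin 2]→L[ℝ] ℝ} {G₀ : Matrix ι ι ℚ}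

/-- **`(⋀^{2p} V_X)^{G_div(X)} ⊆ Bᵖ(X)`**: a rational `2p`-class fixed by every element of `G_div(X)(ℝ)` is a
Hodge class, because `Hg(X) ⊆ G_div(X)` (Moonen–Zarhin (10)) and the Hodge classes are the `Hg(X)`-invariant
rational classes (Thm. 7.2.4). [cite: MoonenZarhin1998WeilClasses, (10) and Lemma (11)(3)]
[cite: Lange2023AbelianVarietiesComplex, §7.2.2 Thm. 7.2.4] -/
theorem mem_hodgeClasses_of_forall_mem_divisorClassGroup (h₀ : ∀ u v : E, η₀ ![I • u, I • v] = η₀ ![u, v])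
    (hG₀ : G₀.map ((↑) : ℚ → ℝ) = latticeGram Φ η₀) (hdet : IsUnit G₀.det) {p : ℕ}
    {γ : E [⋀^Fin (2 * p)]→L[ℝ] ℂ} (hγ : γ ∈ rationalForms Φ (2 * p))
    (hfix : ∀ M ∈ divisorClassGroup Φ η₀, γ.compContinuousLinearMap (analyticRepReal Φ Φ M.1) = γ) :
    γ ∈ hodgeClasses Φ p :=
  (mem_hodgeClasses_iff_forall_mem_hodgeGroup Φ).2
    ⟨hγ, fun M hM ↦ hfix M (hodgeGroup_le_divisorClassGroup h₀ hG₀ hdet hM)⟩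

/-- **Moonen–Zarhin, Lemma (11)(3): `(⋀² V_X)^{G_div(X)} = B¹(X)`** on rational classes — a rational `2`-class
is fixed by `G_div(X)(ℝ)` if and only if it is a Hodge class (a divisor class, Lefschetz `(1,1)`): `⇒` by
`Hg(X) ⊆ G_div(X)`, `⇐` because `G_div(X)(ℝ)` is the stabiliser of `B¹(X)` (FILE 1,
`formsStabilizer_hodgeClasses_one_eq_divisorClassGroup`). [cite: MoonenZarhin1998WeilClasses, Lemma (11)(3)] -/
theorem mem_hodgeClasses_one_iff_forall_mem_divisorClassGroup (h₀ : ∀ u v : E, η₀ ![I • u, I • v] = η₀ ![u, v])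
    (hG₀ : G₀.map ((↑) : ℚ → ℝ) = latticeGram Φ η₀) (hdet : IsUnit G₀.det)
    {γ : E [⋀^Fin (2 * 1)]→L[ℝ] ℂ} (hγ : γ ∈ rationalForms Φ (2 * 1)) :
    γ ∈ hodgeClasses Φ 1 ↔
      ∀ M ∈ divisorClassGroup Φ η₀, γ.compContinuousLinearMap (analyticRepReal Φ Φ M.1) = γ := by
  refine ⟨fun h M hM ↦ ?_, mem_hodgeClasses_of_forall_mem_divisorClassGroup h₀ hG₀ hdet hγ⟩
  rw [← formsStabilizer_hodgeClasses_one_eq_divisorClassGroup h₀ hG₀ hdet] at hM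
  exact hM γ h

/-- For a polarised abelian variety `(X, L₀)`: the `G_div(X)`-invariant rational `2p`-classes are Hodge classes.
[cite: MoonenZarhin1998WeilClasses, (10) and Lemma (11)(3)] -/
theorem IsRiemannForm.mem_hodgeClasses_of_forall_mem_divisorClassGroup (h : IsRiemannForm Φ η₀) {p : ℕ}
    {γ : E [⋀^Fin (2 * p)]→L[ℝ] ℂ} (hγ : γ ∈ rationalForms Φ (2 * p))
    (hfix : ∀ M ∈ divisorClassGroup Φ η₀, γ.compContinuousLinearMap (analyticRepReal Φ Φ M.1) = γ) :
    γ ∈ hodgeClasses Φ p :=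
  (mem_hodgeClasses_iff_forall_mem_hodgeGroup Φ).2 ⟨hγ, fun M hM ↦ hfix M (h.hodgeGroup_le_divisorClassGroup hM)⟩

/-- For a polarised abelian variety `(X, L₀)`: **`(⋀² V_X)^{G_div(X)} = B¹(X)`** on rational classes.
[cite: MoonenZarhin1998WeilClasses, Lemma (11)(3)] -/
theorem IsRiemannForm.mem_hodgeClasses_one_iff_forall_mem_divisorClassGroup (h : IsRiemannForm Φ η₀)
    {γ : E [⋀^Fin (2 * 1)]→L[ℝ] ℂ} (hγ : γ ∈ rationalForms Φ (2 * 1)) :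
    γ ∈ hodgeClasses Φ 1 ↔
      ∀ M ∈ divisorClassGroup Φ η₀, γ.compContinuousLinearMap (analyticRepReal Φ Φ M.1) = γ := by
  obtain ⟨G₀, hG₀, hdet⟩ := h.exists_ratMatrix_latticeGram_isUnit
  exact ComplexTorus.mem_hodgeClasses_one_iff_forall_mem_divisorClassGroup h.1 hG₀ hdet hγ

/-- The squeeze `Dᵖ(X) ⊆ (⋀^{2p} V_X)^{G_div(X)} ⊆ Bᵖ(X)` collapses wherever `Dᵖ(X) = Bᵖ(X)`: then the
`G_div(X)`-invariant rational `2p`-classes are exactly the divisor classes `Dᵖ(X)` (e.g. `p ≤ 1`, `p ≥ g - 1`, or all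
`p` when `Hg(X) = Sp`). [cite: MoonenZarhin1998WeilClasses, Lemma (11)(3)] -/
theorem IsRiemannForm.mem_divisorClasses_iff_forall_mem_divisorClassGroup (h : IsRiemannForm Φ η₀) {p : ℕ}
    (hDB : divisorClasses Φ p = hodgeClasses Φ p) {γ : E [⋀^Fin (2 * p)]→L[ℝ] ℂ}
    (hγ : γ ∈ rationalForms Φ (2 * p)) :
    γ ∈ divisorClasses Φ p ↔
      ∀ M ∈ divisorClassGroup Φ η₀, γ.compContinuousLinearMap (analyticRepReal Φ Φ M.1) = γ :=
  ⟨fun hγD _ hM ↦ h.divisorClassGroup_le_formsStabilizer_divisorClasses p hM γ hγD,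
    fun hfix ↦ hDB ▸ h.mem_hodgeClasses_of_forall_mem_divisorClassGroup hγ hfix⟩

end InvariantsAreHodge

end ComplexTorus

end Literature.Geometry.Kaehler
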